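import Summits.HodgeConjecture.CorCM.MultiFieldWeilNonIsomorphicFamilies
import Summits.HodgeConjecture.CorCM.MultiFieldWeilSimpleFamiliesCurveFree
import HarnessLib

/-!
# MULTI-FIELD WEIL ENGINE — NO TOWER, SIMPLE FORM: any number of SIMPLE CM threefolds over sextic fields through `k`, pairwise «outside each other's Galois closures»
# (e.g. pairwise non-isomorphic), and Weil-type fivefolds over decic fields with stabiliser-transitive automorphisms — the Hodge conjecture for every product of copies with
# the CM elliptic curve of `k`, GIVEN ONLY Markman's theorems

Cell `pub-hodgecm2` (COR-CM), seat b30 gen 35 (2026-08-25); count-neutral own lane MULTI-FIELD WEIL ENGINE (stem `MultiFieldWeil*`); the type hypotheses of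
`CorCM/MultiFieldWeilNonIsomorphicFamilies.lean` (§3–§4: one ∕ two members over `τ`) replaced by SIMPLICITY ∕ WEIL TYPE exactly as gen 33's `CorCM/MultiFieldWeilSimpleFamilies.lean`
did for the towers (slotwise change of CM structure on the same varieties, `exists_realisations_of_forall_succ`).  Theorems only; no definition, no named fact, no `sorry`.  HONEST
FRAMING: conditional on the displayed Markman binders only; `HC_CM` is NOT proved and not asserted.

* §1 **`hodgeConjectureFor_biproduct_comp_of_simpleThreefolds_of_outside_closures`** — `E = A 0 ⊨ (k; {τ})`, `T_m = A (m+1) ⊨ (K_m; Φ (m+1))` SIMPLE CM threefolds over SEXTIC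
  `K_m ⊇ i_m(k)` such that for `m₀ ≠ m` every `τ`-embedding of `K_m` takes a value outside the Galois closure of `K_{m₀}` in `ℂ` (PAIRWISE; for sextic CM fields through `k`:
  `K_m ≇ K_{m₀}`): the Hodge conjecture for EVERY product of copies `⨁_j A (κ j)`, GIVEN ONLY `Markman2025_weilClasses_algebraic_abelianFourfold`.  This SUPERSEDES gen 33's
  `…_of_simpleThreefolds_of_cubicTower` (whose hypothesis `htower` implies the present one and forbids e.g. `k(∛2), k(∛3), k(∛6)`).
* §2 **`hodgeConjectureFor_biproduct_comp_of_simpleThreefolds_weilFivefolds_of_stabiliserTransitive`** — sextic SIMPLE threefolds and decic WEIL-TYPE fivefolds (`k`-signature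
  `(2,3)` ∕ `(3,2)`) together, under stabiliser-transitive automorphisms (`hST`), GIVEN Markman's fourfold + hyperbolic-sixfold theorems.

[cite: Markman2025SurveySecant, Thm. 1.2] [cite: Markman2025SecantWeil, Thm 1.5.1] [cite: Shimura1998, §8.2 Prop. 26, §8.4, §18.2 Lemma (i)] [cite: Pohlmann1968, Thm 1]
[cite: MoonenZarhin1995Duke, Thm. 2.4] [cite: Lang2002, VI §1 Thm. 1.1 and Cor. 1.6] [cite: MumfordAV1970, §19]

## References
* [Markman2025SurveySecant] E. Markman, arXiv:2509.23403, Thm. 1.2.  [Markman2025SecantWeil] E. Markman, Cycles on abelian 2n-folds of Weil type from secant sheaves, Thm 1.5.1.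
  [Shimura1998] G. Shimura, *Abelian varieties with complex multiplication and modular functions*, §8.2, §8.4, §18.2.  [Pohlmann1968] H. Pohlmann, Ann. of Math. 88 (1968), Thm 1.
  [MoonenZarhin1995Duke] B. Moonen, Yu. Zarhin, Duke Math. J. 77 (1995), Thm. 2.4.  [Lang2002] S. Lang, *Algebra*, GTM 211, VI §1.  [MumfordAV1970] D. Mumford, *Abelian Varieties*, §19.
-/

noncomputable section

open CategoryTheory CategoryTheory.Limits NumberField IntermediateField

namespace Summit.HodgeConjecture.CorCM.MultiFieldWeil

open Finset
open Literature.AlgebraicGeometry Literature.AlgebraicGeometry.Motives Literature.AlgebraicGeometry.HodgeTheory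
open Literature.AlgebraicGeometry.ComplexMultiplication (IsCMTypeRealisation)
open Literature.AlgebraicTopology.SingularHomology
open Literature.NumberTheory.ComplexMultiplication

open scoped Classical

section Engine

variable {I : Type} {r : ℕ} {Kf : I → Type} [∀ i, Field (Kf i)] [∀ i, NumberField (Kf i)] [∀ i, IsCMField (Kf i)]
  {i₀ : I} {is : Fin r → I} {τ : Kf i₀ →+* ℂ}
  {A : Fin (r + 1) → AbelianVariety ℂ} {Φ : ∀ j : Fin (r + 1), CMType (Kf (mfSlots i₀ is j))}
  {ι : ∀ j, 𝓞 (Kf (mfSlots i₀ is j)) →+* End (A j)}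
  {θ : ∀ j, Kf (mfSlots i₀ is j) →+* Module.End ℂ (complexBetti (A j).X 1)}

/-! ## §1 Simple CM threefolds over sextic fields pairwise outside each other's Galois closures -/

/-- **ANY NUMBER OF SIMPLE CM THREEFOLDS OVER SEXTIC FIELDS THROUGH `k`, PAIRWISE OUTSIDE EACH OTHER'S GALOIS CLOSURES — given ONLY Markman's fourfold theorem; NO TOWER.**
`E = A 0 ⊨ (k; {τ})`, `k = Kf i₀` imaginary quadratic; `T_m = A (m+1) ⊨ (K_m; Φ (m+1))` SIMPLE abelian threefolds over SEXTIC `K_m = Kf (is m) ⊇ im m (k)` — no hypothesis on the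
types; for `m₀ ≠ m` every `τ`-embedding of `K_m` takes a value outside `normalClosure ℚ (K_{m₀}) ℂ`.  Then the Hodge conjecture holds for EVERY product of copies `⨁_j A (κ j)`.
(Types normalised slot by slot to one member over `τ` on the same varieties; then `hodgeConjectureFor_biproduct_comp_of_sextics_of_outside_closures`.)  `HC_CM` is NOT asserted.
[cite: Markman2025SurveySecant, Thm. 1.2] [cite: Shimura1998, §8.2 Prop. 26, §18.2 Lemma (i)] [cite: Lang2002, VI §1 Thm. 1.1 and Cor. 1.6] -/
theorem hodgeConjectureFor_biproduct_comp_of_simpleThreefolds_of_outside_closures (hW4 : Markman2025_weilClasses_algebraic_abelianFourfold)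
    {N : ℕ} (κ : Fin N → Fin (r + 1)) (h2 : Module.finrank ℚ (Kf i₀) = 2) (h6 : ∀ m : Fin r, Module.finrank ℚ (Kf (is m)) = 6)
    (im : ∀ m : Fin r, Kf i₀ →+* Kf (is m)) (hA : ∀ j, IsCMTypeRealisation (Φ j) (A j) (ι j) (θ j)) (hΨ : ∀ σ : Kf i₀ →+* ℂ, σ ∈ (Φ 0).1 ↔ σ = τ)
    (hS : ∀ m : Fin r, (A m.succ).IsSimple)
    (hout : ∀ (m₀ m : Fin r), m₀ ≠ m → ∀ s : Kf (is m) →+* ℂ, s.comp (im m) = τ → ∃ x, s x ∉ normalClosure ℚ (Kf (is m₀)) ℂ) :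
    HodgeConjectureFor (⨁ fun j => A (κ j)).dim (⨁ fun j => A (κ j)).X := by
  obtain ⟨Φ', ι', θ', hA', h0, h1⟩ := exists_realisations_of_forall_succ hA
    (fun m Φ' => (Finset.univ.filter fun s : Kf (is m) →+* ℂ => s.comp (im m) = τ ∧ s ∈ Φ'.1).card = 1)
    (fun m => exists_realisation_card_eq_one (h6 m) h2 (im m) (hA m.succ) τ
      (card_filter_mem_eq_one_or_two_of_isSimple (h6 m) h2 (im m) (hA m.succ) (hS m) τ))
  have hΨ' : ∀ σ : Kf i₀ →+* ℂ, σ ∈ (Φ' 0).1 ↔ σ = τ := by rw [h0]; exact hΨ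
  exact hodgeConjectureFor_biproduct_comp_of_sextics_of_outside_closures hW4 κ h2 h6 im hA' hΨ' h1 hout

/-- **Dominated form**: everything dominated by a product of copies of `E` and of the simple threefolds `T_m`. [cite: Markman2025SurveySecant, Thm. 1.2] [cite: MumfordAV1970, §19 Thm. 1 and p. 169] -/
theorem hodgeConjectureFor_of_avDominatedBy_comp_of_simpleThreefolds_of_outside_closures (hW4 : Markman2025_weilClasses_algebraic_abelianFourfold)
    {N : ℕ} (κ : Fin N → Fin (r + 1)) (h2 : Module.finrank ℚ (Kf i₀) = 2) (h6 : ∀ m : Fin r, Module.finrank ℚ (Kf (is m)) = 6)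
    (im : ∀ m : Fin r, Kf i₀ →+* Kf (is m)) (hA : ∀ j, IsCMTypeRealisation (Φ j) (A j) (ι j) (θ j)) (hΨ : ∀ σ : Kf i₀ →+* ℂ, σ ∈ (Φ 0).1 ↔ σ = τ)
    (hS : ∀ m : Fin r, (A m.succ).IsSimple)
    (hout : ∀ (m₀ m : Fin r), m₀ ≠ m → ∀ s : Kf (is m) →+* ℂ, s.comp (im m) = τ → ∃ x, s x ∉ normalClosure ℚ (Kf (is m₀)) ℂ)
    {X : AbelianVariety ℂ} (hX : Domination.AVDominatedBy X (⨁ fun j => A (κ j))) : HodgeConjectureFor X.dim X.X :=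
  Domination.hodgeConjectureFor_of_avDominatedBy
    (hodgeConjectureFor_biproduct_comp_of_simpleThreefolds_of_outside_closures hW4 κ h2 h6 im hA hΨ hS hout) hX

/-! ## §2 Simple threefolds and Weil-type fivefolds together, stabiliser-transitive automorphisms -/

/-- **SIMPLE CM THREEFOLDS (sextic) AND WEIL-TYPE CM FIVEFOLDS (decic, `k`-signature `(2,3)` ∕ `(3,2)`) SHARING `k`, STABILISER-TRANSITIVE — given Markman's fourfold and
hyperbolic-sixfold theorems; NO TOWER.**  `n m ∈ {3, 5}`, `[K_m : ℚ] = 2 n_m`; sextic slots carry SIMPLE threefolds, decic slots carry types with two or three members over `τ`;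
for `m₀ ≠ m` and `τ`-embeddings `s, s'` of `K_m` some automorphism of `ℂ` over `τ(k)` fixes all `τ`-embeddings of `K_{m₀}` and carries `s` to `s'`.  Then the Hodge conjecture
holds for EVERY product of copies `⨁_j A (κ j)`.  `HC_CM` is NOT asserted. [cite: Markman2025SurveySecant, Thm. 1.2] [cite: Markman2025SecantWeil, Thm 1.5.1]
[cite: Shimura1998, §8.2 Prop. 26, §18.2 Lemma (i)] -/
theorem hodgeConjectureFor_biproduct_comp_of_simpleThreefolds_weilFivefolds_of_stabiliserTransitive (hW4 : Markman2025_weilClasses_algebraic_abelianFourfold)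
    (hM6 : Markman2025_weilClasses_algebraic_hyperbolicSixfold) (n : Fin r → ℕ) (hn : ∀ m, n m = 3 ∨ n m = 5)
    {N : ℕ} (κ : Fin N → Fin (r + 1)) (h2 : Module.finrank ℚ (Kf i₀) = 2) (hdeg : ∀ m : Fin r, Module.finrank ℚ (Kf (is m)) = 2 * n m)
    (im : ∀ m : Fin r, Kf i₀ →+* Kf (is m)) (hA : ∀ j, IsCMTypeRealisation (Φ j) (A j) (ι j) (θ j)) (hΨ : ∀ σ : Kf i₀ →+* ℂ, σ ∈ (Φ 0).1 ↔ σ = τ)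
    (hS : ∀ m : Fin r, n m = 3 → (A m.succ).IsSimple)
    (h23 : ∀ m : Fin r, n m = 5 → (Finset.univ.filter fun s : Kf (is m) →+* ℂ => s.comp (im m) = τ ∧ s ∈ (Φ m.succ).1).card = 2 ∨
      (Finset.univ.filter fun s : Kf (is m) →+* ℂ => s.comp (im m) = τ ∧ s ∈ (Φ m.succ).1).card = 3)
    (hST : ∀ (m₀ m : Fin r), m₀ ≠ m → ∀ s s' : Kf (is m) →+* ℂ, s.comp (im m) = τ → s'.comp (im m) = τ →
      ∃ ρ : ℂ ≃+* ℂ, (ρ : ℂ →+* ℂ).comp τ = τ ∧ (∀ u : Kf (is m₀) →+* ℂ, u.comp (im m₀) = τ → (ρ : ℂ →+* ℂ).comp u = u) ∧ (ρ : ℂ →+* ℂ).comp s = s') :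
    HodgeConjectureFor (⨁ fun j => A (κ j)).dim (⨁ fun j => A (κ j)).X := by
  -- the target member counts: one over `τ` on sextic slots, two on decic slots
  let p : Fin r → ℕ := fun m => if n m = 3 then 1 else 2
  obtain ⟨Φ', ι', θ', hA', h0, hp⟩ := exists_realisations_of_forall_succ hA
    (fun m Φ' => (Finset.univ.filter fun s : Kf (is m) →+* ℂ => s.comp (im m) = τ ∧ s ∈ Φ'.1).card = p m)
    (fun m => by
      rcases hn m with h3 | h5
      · have h6 : Module.finrank ℚ (Kf (is m)) = 6 := by rw [hdeg m, h3]
        obtain ⟨Φ', ι', θ', hT, h1⟩ := exists_realisation_card_eq_one h6 h2 (im m) (hA m.succ) τ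
          (card_filter_mem_eq_one_or_two_of_isSimple h6 h2 (im m) (hA m.succ) (hS m h3) τ)
        exact ⟨Φ', ι', θ', hT, by simp only [p, if_pos h3]; exact h1⟩
      · have h10 : Module.finrank ℚ (Kf (is m)) = 10 := by rw [hdeg m, h5]
        obtain ⟨Φ', ι', θ', hT, h2'⟩ := exists_realisation_card_eq_two h10 h2 (im m) (hA m.succ) τ (h23 m h5)
        exact ⟨Φ', ι', θ', hT, by simp only [p, h5, if_neg (show (5 : ℕ) ≠ 3 by decide)]; exact h2'⟩)
  have hΨ' : ∀ σ : Kf i₀ →+* ℂ, σ ∈ (Φ' 0).1 ↔ σ = τ := by rw [h0]; exact hΨ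
  refine hodgeConjectureFor_biproduct_comp_of_sexticsDecics_of_stabiliserTransitive hW4 hM6 n p (fun m => ?_) κ h2 hdeg im hA' hΨ' hp hST
  rcases hn m with h3 | h5
  · exact Or.inl ⟨h3, by simp only [p, if_pos h3]⟩
  · exact Or.inr ⟨h5, by simp only [p, h5, if_neg (show (5 : ℕ) ≠ 3 by decide)]⟩

end Engine

/-! ## §3 No curve in the statement -/

section CurveFree

variable {I : Type} {r : ℕ} {Kf : I → Type} [∀ i, Field (Kf i)] [∀ i, NumberField (Kf i)] [∀ i, IsCMField (Kf i)]
  {i₀ : I} {is : Fin r → I}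
  {T : Fin r → AbelianVariety ℂ} {ΦT : ∀ m : Fin r, CMType (Kf (is m))}
  {ιT : ∀ m, 𝓞 (Kf (is m)) →+* End (T m)} {θT : ∀ m, Kf (is m) →+* Module.End ℂ (complexBetti (T m).X 1)}

/-- **ANY NUMBER OF SIMPLE CM THREEFOLDS WHOSE SEXTIC CM FIELDS CONTAIN `k` AND LIE PAIRWISE OUTSIDE EACH OTHER'S GALOIS CLOSURES — given ONLY Markman's fourfold theorem; no
curve in the statement, no tower.**  `k = Kf i₀` imaginary quadratic with a chosen complex embedding `τ`; `T_m ⊨ (K_m; ΦT m)` (`m < r`) SIMPLE abelian threefolds with CM by SEXTIC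
`K_m = Kf (is m) ⊇ im m (k)` — nothing assumed on the types; for `m₀ ≠ m` every `τ`-embedding of `K_m` takes a value outside `normalClosure ℚ (K_{m₀}) ℂ`.  Then for every
`κ : Fin N → Fin r` the Hodge conjecture holds for `⨁_j T (κ j)` — EVERY `T_0^{b_0} × ⋯ × T_{r−1}^{b_{r−1}}` — GIVEN ONLY `Markman2025_weilClasses_algebraic_abelianFourfold` (a CM
elliptic curve `E ⊨ (k; {τ})` is adjoined as slot `0`, and §1 is restricted to the slots `≥ 1`).  `HC_CM` is NOT asserted. [cite: Markman2025SurveySecant, Thm. 1.2]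
[cite: Shimura1998, §6.2 Thm. 3, §8.2 Prop. 26, §18.2 Lemma (i)] [cite: Lang2002, VI §1 Thm. 1.1 and Cor. 1.6] -/
theorem hodgeConjectureFor_biproduct_comp_of_simpleThreefolds_of_outside_closures_curveFree (hW4 : Markman2025_weilClasses_algebraic_abelianFourfold)
    {N : ℕ} (κ : Fin N → Fin r) (h2 : Module.finrank ℚ (Kf i₀) = 2) (h6 : ∀ m : Fin r, Module.finrank ℚ (Kf (is m)) = 6)
    (im : ∀ m : Fin r, Kf i₀ →+* Kf (is m)) (hT : ∀ m, IsCMTypeRealisation (ΦT m) (T m) (ιT m) (θT m)) (hS : ∀ m, (T m).IsSimple) (τ : Kf i₀ →+* ℂ)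
    (hout : ∀ (m₀ m : Fin r), m₀ ≠ m → ∀ s : Kf (is m) →+* ℂ, s.comp (im m) = τ → ∃ x, s x ∉ normalClosure ℚ (Kf (is m₀)) ℂ) :
    HodgeConjectureFor (⨁ fun j => T (κ j)).dim (⨁ fun j => T (κ j)).X := by
  obtain ⟨Ψ, E, ιE, θE, hE, hΨ⟩ := exists_cmCurve_iff_eq h2 τ
  obtain ⟨Φ, ι, θ, hA, h0, -⟩ := exists_realisations_cons (is := is) hE hT
  have hΨ' : ∀ σ : Kf i₀ →+* ℂ, σ ∈ (Φ 0).1 ↔ σ = τ := by rw [h0]; exact hΨ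
  have h := hodgeConjectureFor_biproduct_comp_of_simpleThreefolds_of_outside_closures hW4 (fun j => Fin.succ (κ j)) h2 h6 im hA hΨ' (fun m => hS m) hout
  rw [biproduct_cons_succ κ] at h
  exact h

/-- **Dominated form**: everything dominated by a product of copies of the simple threefolds `T_m`. [cite: Markman2025SurveySecant, Thm. 1.2] [cite: MumfordAV1970, §19 Thm. 1 and p. 169] -/
theorem hodgeConjectureFor_of_avDominatedBy_comp_of_simpleThreefolds_of_outside_closures_curveFree (hW4 : Markman2025_weilClasses_algebraic_abelianFourfold)
    {N : ℕ} (κ : Fin N → Fin r) (h2 : Module.finrank ℚ (Kf i₀) = 2) (h6 : ∀ m : Fin r, Module.finrank ℚ (Kf (is m)) = 6)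
    (im : ∀ m : Fin r, Kf i₀ →+* Kf (is m)) (hT : ∀ m, IsCMTypeRealisation (ΦT m) (T m) (ιT m) (θT m)) (hS : ∀ m, (T m).IsSimple) (τ : Kf i₀ →+* ℂ)
    (hout : ∀ (m₀ m : Fin r), m₀ ≠ m → ∀ s : Kf (is m) →+* ℂ, s.comp (im m) = τ → ∃ x, s x ∉ normalClosure ℚ (Kf (is m₀)) ℂ)
    {X : AbelianVariety ℂ} (hX : Domination.AVDominatedBy X (⨁ fun j => T (κ j))) : HodgeConjectureFor X.dim X.X :=
  Domination.hodgeConjectureFor_of_avDominatedBy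
    (hodgeConjectureFor_biproduct_comp_of_simpleThreefolds_of_outside_closures_curveFree hW4 κ h2 h6 im hT hS τ hout) hX

end CurveFree

end Summit.HodgeConjecture.CorCM.MultiFieldWeil

end
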